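import Mathlib
import Literature.Analysis.FluidPDE.Tao2016AveragedNS.BoundedEternalSolutions
import Summits.NavierStokesRegularity.NavierStokesRegularity.Theses.TaoLadderRungTwoBreak
import Summits.NavierStokesRegularity.NavierStokesRegularity.Theorems.TaoLadderRungTwoBreakNoSurvivingEternalViscBddOneWakeDyadicDSSTerminalDrift
import Summits.NavierStokesRegularity.NavierStokesRegularity.Theorems.TaoLadderRungTwoBreakNoSurvivingEternalViscBddOneWakeDyadicLifetimeFeedDrain
import Summits.NavierStokesRegularity.NavierStokesRegularity.Theorems.TaoLadderRungTwoBreakNoSurvivingEternalViscBddOneWakeDyadicEnergyFluxIdentity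

/-!
# Crux `TaoLadderRungTwoBreak.NoSurvivingEternalViscBddOne` (stmt-NavierStokesRegularity-20419), stub (ρ0), DYADIC MEMBER / DSS
# STRATUM (⟨20205⟩): the EXACT OVERSHOOT FLOOR of a discretely self-similar front —
# `sup_t V_n(t) ≥ v_n · (Λ² − κ^{3/2}) / (2(Λ² − κ²))`

MODEL lattice ODEs only (the non-negative Katz–Pavlović / Desnianskii–Novikov chain in Tao's critical variables,
`V̇_n = Λ V_{n-1}² − Λ⁻¹ V_n V_{n+1}` on `t < 0`, `Λ = (1+ε₀)^{5/2}`); nothing in this file is a statement about the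
Navier–Stokes equations, and no stub, crux, rung or summit is proved by it (`--supports stmt-NavierStokesRegularity-20419`).
DEF-FREE.  It COMBINES the three identities landed by this hand — (D) `…WakeDyadicDSSTerminalDrift` (`v_{n+1} = κv_n`),
(I1) `…WakeDyadicLifetimeFeedDrain` (`v_n = Λ∫V_{n-1}² − Λ⁻¹∫V_nV_{n+1}`) and (I2) `…WakeDyadicEnergyFluxIdentity`
(stranded energy above a bond ≤ lifetime flux through it) — into one exact inequality for every non-negative period-one DSS
solution (`V_{k+1}(t) = κV_k(κt)`, `0 < κ < Λ`) born at rest with lifetime-integrable feeds, drains and fluxes: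

* `setIntegral_Iio_comp_mul` / `integral_sq_dss` — scaling of the lifetime feed: `∫V_{n+1}² = κ ∫V_n²`;
* `integral_drain_le` — AM–GM: `∫V_nV_{n+1} ≤ √κ ∫V_n²`;
* `feed_le_terminal` — with (I1): `(Λ − κ√κ/Λ) ∫V_{n-1}² ≤ v_n`;
* `flux_le_sup_mul_feed` — `∫Π_{n-1} ≤ 2Λ^{-2(n-1)}Λ⁻¹ · S · ∫V_{n-1}²` for any bound `V_n ≤ S`;
* `dss_terminal_shift`, `strandedEnergy_dss_ge` — with (D): `Λ^{-2n}v_n²/(1 − κ²/Λ²) ≤ Σ_{j≥0} Λ^{-2(n+j)}v_{n+j}²`, and with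
  (I2) the latter is `≤ ∫Π_{n-1}`;
* **`dss_overshoot_floor`** — hence for every `S` with `V_n ≤ S` on `t < 0`:

      `v_n · (Λ² − κ√κ) / (2(Λ² − κ²)) ≤ S`.

  READING.  Write `κ = Λ^θ` (`θ` = 1 − terminal exponent; K41 `θ = 2/3`, (S₁) threshold `θ = 4/5`).  As the base tends to one the
  factor is `(2 − (3/2)θ)/(4(1−θ)) + O(log Λ)`: it exceeds `1` — i.e. forces a genuine OVERSHOOT `sup V_n > v_n` by a definite factor —
  exactly when `θ > 4/5` (exact condition `2κ² − κ√κ > Λ²`, `dss_strict_overshoot`), and tends to `+∞` as `θ → 1`.  So the (S₁)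
  threshold of the cell's calibration reappears, from the exact identities alone, as the onset of FORCED overshoot on the DSS stratum of
  the dyadic member; with the tree's no-overshoot bound `sup V_n ≤ e^{M/Λ}v_n` (`…WakeDyadicAncientApriori.noOvershoot`) it yields the
  quantitative sub-unitarity `Λ² − κ√κ ≤ 2e^{M/Λ}(Λ² − κ²)` (`dss_subunitary_quantitative`) — a rate bound in terms of the action
  alone (the tree's `dssMu_lt_one` is the qualitative `κ < Λ`).

HONEST LABEL: elementary real analysis on top of the hand's identity files; the estimate that would close W1-dyadic on the DSS
stratum is an overshoot CEILING uniform as `Λ ↓ 1` (memo `W1-DSS-identities-memo-leafhand4-g24.md`, item (OV)), not this floor;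
W1-dyadic, (ρ0), ⟨20419⟩, ⟨20205⟩ and every NS statement remain OPEN; rung 0.
-/

-- the summit and its single sub-problem share the name (CONVENTIONS §1)
set_option linter.dupNamespace false

namespace Summit.NavierStokesRegularity.NavierStokesRegularity.Theorems.NoSurvivingEternalViscBddOne.DSSOvershootFloor

open Filter Topology Set MeasureTheory Finset
open Literature.Analysis.FluidPDE.TaoCascade
open Summit.NavierStokesRegularity.NavierStokesRegularity.Theorems.NoSurvivingEternalViscBddOne

variable {ε₀ κ : ℝ} {V : ℤ → ℝ → ℝ} {v : ℤ → ℝ} {P : ℤ → ℝ → ℝ}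

/-! ## Change of variables in the improper integral and the DSS scaling of the feed -/

/-- `∫_{x<a} g(bx) dx = b⁻¹ ∫_{x<ba} g(x) dx` for `b > 0` (mirror of Mathlib's `integral_comp_mul_left_Ioi`). [folklore] -/
theorem setIntegral_Iio_comp_mul (g : ℝ → ℝ) (a : ℝ) {b : ℝ} (hb : 0 < b) :
    (∫ x in Iio a, g (b * x)) = b⁻¹ * ∫ x in Iio (b * a), g x := by
  have hm : ∀ c : ℝ, MeasurableSet (Iio c) := fun c => measurableSet_Iio
  rw [← integral_indicator (hm a), ← integral_indicator (hm (b * a)), ← smul_eq_mul,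
    ← abs_of_pos (inv_pos.mpr hb), ← Measure.integral_comp_mul_left]
  congr
  ext1 x
  rw [← indicator_comp_right, preimage_const_mul_Iio₀ _ hb, mul_div_cancel_left₀ _ hb.ne', Function.comp_def]

/-- **DSS scaling of the lifetime feed**: `∫_{(−∞,0)} V_{n+1}² = κ ∫_{(−∞,0)} V_n²` (`V_{n+1}(t) = κV_n(κt)` on `t < 0`, `κ > 0`).
[cite: Tao2016AveragedNS, §4 Lemma 4.1 (4.8), §6.4; elementary] -/
theorem integral_sq_dss (hκ : 0 < κ)
    (hdss : ∀ (n : ℤ) (t : ℝ), t < 0 → V (n + 1) t = κ * V n (κ * t)) (n : ℤ) :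
    ∫ t in Iio 0, V (n + 1) t ^ 2 = κ * ∫ t in Iio 0, V n t ^ 2 := by
  have h1 : ∫ t in Iio 0, V (n + 1) t ^ 2 = ∫ t in Iio 0, κ ^ 2 * (fun s => V n s ^ 2) (κ * t) := by
    refine setIntegral_congr_fun measurableSet_Iio fun t ht => ?_
    simp only
    rw [hdss n t ht]; ring
  rw [h1, integral_const_mul, setIntegral_Iio_comp_mul (fun s => V n s ^ 2) 0 hκ, mul_zero]
  field_simp

/-- **AM–GM bound on the lifetime drain of a DSS front**: `∫_{(−∞,0)} V_nV_{n+1} ≤ √κ ∫_{(−∞,0)} V_n²`.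
[cite: Tao2016AveragedNS, §4 Lemma 4.1 (4.8), §6.4; elementary] -/
theorem integral_drain_le (hκ : 0 < κ)
    (hdss : ∀ (n : ℤ) (t : ℝ), t < 0 → V (n + 1) t = κ * V n (κ * t))
    (hsq : ∀ k : ℤ, IntegrableOn (fun t => V k t ^ 2) (Iio 0))
    (hdr : ∀ k : ℤ, IntegrableOn (fun t => V k t * V (k + 1) t) (Iio 0)) (n : ℤ) :
    ∫ t in Iio 0, V n t * V (n + 1) t ≤ Real.sqrt κ * ∫ t in Iio 0, V n t ^ 2 := by
  set s := Real.sqrt κ with hs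
  have hs0 : 0 < s := Real.sqrt_pos.2 hκ
  have hss : s * s = κ := Real.mul_self_sqrt hκ.le
  -- pointwise: `ab ≤ (s a² + b²/s)/2`
  have hpt : ∀ t ∈ Iio (0 : ℝ), V n t * V (n + 1) t ≤ (s / 2) * V n t ^ 2 + (1 / (2 * s)) * V (n + 1) t ^ 2 := by
    intro t _
    have hsq' : 0 ≤ (s * V n t - V (n + 1) t) ^ 2 := sq_nonneg _
    have e : (s / 2) * V n t ^ 2 + (1 / (2 * s)) * V (n + 1) t ^ 2 - V n t * V (n + 1) t
        = (s * V n t - V (n + 1) t) ^ 2 / (2 * s) := by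
      field_simp
      ring
    have : 0 ≤ (s / 2) * V n t ^ 2 + (1 / (2 * s)) * V (n + 1) t ^ 2 - V n t * V (n + 1) t := by
      rw [e]; positivity
    linarith
  have hint : IntegrableOn (fun t => (s / 2) * V n t ^ 2 + (1 / (2 * s)) * V (n + 1) t ^ 2) (Iio 0) :=
    ((hsq n).const_mul _).add ((hsq (n + 1)).const_mul _)
  have hle := setIntegral_mono_on (hdr n) hint measurableSet_Iio hpt
  rw [integral_add ((hsq n).const_mul _) ((hsq (n + 1)).const_mul _), integral_const_mul, integral_const_mul,
    integral_sq_dss hκ hdss n] at hle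
  have e2 : s / 2 * (∫ t in Iio 0, V n t ^ 2) + 1 / (2 * s) * (κ * ∫ t in Iio 0, V n t ^ 2)
      = s * ∫ t in Iio 0, V n t ^ 2 := by
    rw [← hss]; field_simp; ring
  linarith

/-! ## Feed, terminal value and flux -/

/-- **Feed vs. terminal value** (from (I1) `v_n = Λ∫V_{n-1}² − Λ⁻¹∫V_nV_{n+1}`, the drain bound and the feed scaling):
`(Λ − κ√κ/Λ) ∫_{(−∞,0)} V_{n-1}² ≤ v_n`.  [cite: Tao2016AveragedNS, §1.2, §4 Lemma 4.1 (4.8), §6.4; elementary] -/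
theorem feed_le_terminal (hκ : 0 < κ)
    (hV : ∀ (n : ℤ) (t : ℝ), t < 0 →
      HasDerivAt (V n) (bigLam ε₀ * V (n - 1) t ^ 2 - (bigLam ε₀)⁻¹ * (V n t * V (n + 1) t)) t)
    (hdss : ∀ (n : ℤ) (t : ℝ), t < 0 → V (n + 1) t = κ * V n (κ * t))
    (hv : ∀ n : ℤ, Tendsto (V n) (𝓝[<] 0) (𝓝 (v n)))
    (hpast : ∀ k : ℤ, Tendsto (V k) atBot (𝓝 0))
    (hsq : ∀ k : ℤ, IntegrableOn (fun t => V k t ^ 2) (Iic 0))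
    (hdr : ∀ k : ℤ, IntegrableOn (fun t => V k t * V (k + 1) t) (Iic 0)) (hε : 0 < ε₀) (n : ℤ) :
    (bigLam ε₀ - κ * Real.sqrt κ / bigLam ε₀) * (∫ t in Iio 0, V (n - 1) t ^ 2) ≤ v n := by
  have hΛ : 0 < bigLam ε₀ := bigLam_pos (by linarith)
  have hsq' : ∀ k : ℤ, IntegrableOn (fun t => V k t ^ 2) (Iio 0) := fun k => (hsq k).mono_set Iio_subset_Iic_self
  have hdr' : ∀ k : ℤ, IntegrableOn (fun t => V k t * V (k + 1) t) (Iio 0) :=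
    fun k => (hdr k).mono_set Iio_subset_Iic_self
  have hI1 := LifetimeFeedDrain.terminal_eq_feed_sub_drain hV hv n (hpast n) (hsq (n - 1)) (hdr n)
  have hJ := integral_drain_le hκ hdss hsq' hdr' n
  -- `∫V_n² = κ∫V_{n-1}²`
  have hIn : ∫ t in Iio 0, V n t ^ 2 = κ * ∫ t in Iio 0, V (n - 1) t ^ 2 := by
    have h := integral_sq_dss hκ hdss (n - 1)
    rw [sub_add_cancel] at h
    exact h
  rw [hIn] at hJ
  have hJ' : (bigLam ε₀)⁻¹ * ∫ t in Iio 0, V n t * V (n + 1) t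
      ≤ (bigLam ε₀)⁻¹ * (Real.sqrt κ * (κ * ∫ t in Iio 0, V (n - 1) t ^ 2)) :=
    mul_le_mul_of_nonneg_left hJ (inv_nonneg.2 hΛ.le)
  have e : (bigLam ε₀ - κ * Real.sqrt κ / bigLam ε₀) * (∫ t in Iio 0, V (n - 1) t ^ 2)
      = bigLam ε₀ * (∫ t in Iio 0, V (n - 1) t ^ 2)
        - (bigLam ε₀)⁻¹ * (Real.sqrt κ * (κ * ∫ t in Iio 0, V (n - 1) t ^ 2)) := by
    rw [div_eq_mul_inv]
    ring
  rw [e, hI1]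
  linarith

/-- **Flux through bond `n−1` vs. a bound on shell `n`**: if `V_n ≤ S` on `t < 0` then
`∫_{(−∞,0)} Π_{n-1} ≤ 2Λ^{-2(n-1)}Λ⁻¹ · S · ∫_{(−∞,0)} V_{n-1}²`.  [cite: Tao2016AveragedNS, §1.2, §4 (4.8)–(4.10); elementary] -/
theorem flux_le_sup_mul_feed (hε : 0 < ε₀)
    (hP : ∀ k t, P k t = 2 * (((bigLam ε₀ ^ k)⁻¹) ^ 2 * (bigLam ε₀)⁻¹) * (V k t ^ 2 * V (k + 1) t))
    (hsq : ∀ k : ℤ, IntegrableOn (fun t => V k t ^ 2) (Iic 0))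
    (hPint : ∀ k : ℤ, IntegrableOn (P k) (Iic 0)) (n : ℤ) {S : ℝ} (hS : ∀ t : ℝ, t < 0 → V n t ≤ S) :
    ∫ t in Iio 0, P (n - 1) t
      ≤ 2 * (((bigLam ε₀ ^ (n - 1))⁻¹) ^ 2 * (bigLam ε₀)⁻¹) * S * ∫ t in Iio 0, V (n - 1) t ^ 2 := by
  have hΛ : 0 < bigLam ε₀ := bigLam_pos (by linarith)
  have hw : 0 ≤ 2 * (((bigLam ε₀ ^ (n - 1))⁻¹) ^ 2 * (bigLam ε₀)⁻¹) :=
    mul_nonneg zero_le_two (mul_nonneg (sq_nonneg _) (inv_nonneg.2 hΛ.le))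
  have hpt : ∀ t ∈ Iio (0 : ℝ), P (n - 1) t
      ≤ 2 * (((bigLam ε₀ ^ (n - 1))⁻¹) ^ 2 * (bigLam ε₀)⁻¹) * S * V (n - 1) t ^ 2 := by
    intro t ht
    rw [hP (n - 1) t, sub_add_cancel]
    have h1 : V (n - 1) t ^ 2 * V n t ≤ V (n - 1) t ^ 2 * S :=
      mul_le_mul_of_nonneg_left (hS t ht) (sq_nonneg _)
    have h2 := mul_le_mul_of_nonneg_left h1 hw
    calc 2 * (((bigLam ε₀ ^ (n - 1))⁻¹) ^ 2 * (bigLam ε₀)⁻¹) * (V (n - 1) t ^ 2 * V n t)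
        ≤ 2 * (((bigLam ε₀ ^ (n - 1))⁻¹) ^ 2 * (bigLam ε₀)⁻¹) * (V (n - 1) t ^ 2 * S) := h2
      _ = 2 * (((bigLam ε₀ ^ (n - 1))⁻¹) ^ 2 * (bigLam ε₀)⁻¹) * S * V (n - 1) t ^ 2 := by ring
  have hint : IntegrableOn (fun t => 2 * (((bigLam ε₀ ^ (n - 1))⁻¹) ^ 2 * (bigLam ε₀)⁻¹) * S * V (n - 1) t ^ 2)
      (Iio 0) := ((hsq (n - 1)).mono_set Iio_subset_Iic_self).const_mul _
  have h := setIntegral_mono_on ((hPint (n - 1)).mono_set Iio_subset_Iic_self) hint measurableSet_Iio hpt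
  rwa [integral_const_mul] at h

/-! ## The stranded energy of a DSS front is geometric -/

/-- Terminal values of a DSS solution from base shell `n`: `v_{n+j} = κ^j v_n`. [elementary] -/
theorem dss_terminal_shift (hκ : 0 < κ)
    (hdss : ∀ (n : ℤ) (t : ℝ), t < 0 → V (n + 1) t = κ * V n (κ * t))
    (hv : ∀ n : ℤ, Tendsto (V n) (𝓝[<] 0) (𝓝 (v n))) (n : ℤ) (j : ℕ) :
    v (n + j) = κ ^ j * v n := by
  induction j with
  | zero => simp
  | succ k ih =>
    have h := DSSTerminalDrift.dss_terminal_succ hκ hdss hv (n + k)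
    have e : n + ((k + 1 : ℕ) : ℤ) = n + (k : ℤ) + 1 := by push_cast; ring
    rw [e, h, ih, pow_succ]
    ring

/-- Weight algebra: `Λ^{-2(n+j)} = Λ^{-2n} · (Λ⁻²)^j`. [folklore] -/
theorem weight_shift {Λ : ℝ} (hΛ : Λ ≠ 0) (n : ℤ) (j : ℕ) :
    ((Λ ^ (n + j))⁻¹) ^ 2 = ((Λ ^ n)⁻¹) ^ 2 / Λ ^ (2 * j) := by
  rw [zpow_add₀ hΛ, zpow_natCast]
  have hj : Λ ^ j ≠ 0 := pow_ne_zero j hΛ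
  have hn : Λ ^ n ≠ 0 := zpow_ne_zero n hΛ
  have h2 : Λ ^ (2 * j) ≠ 0 := pow_ne_zero _ hΛ
  field_simp
  ring

/-- **The stranded energy of a DSS front is geometric**: with `v_{n+j} = κ^j v_n` and `0 < κ < Λ`,
`Σ_{j≥0} Λ^{-2(n+j)} v_{n+j}² = Λ^{-2n} v_n² / (1 − κ²/Λ²)`.  [elementary (geometric series)] -/
theorem strandedEnergy_dss_hasSum (hε : 0 < ε₀) (hκ : 0 < κ) (hκΛ : κ < bigLam ε₀)
    (hdss : ∀ (n : ℤ) (t : ℝ), t < 0 → V (n + 1) t = κ * V n (κ * t))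
    (hv : ∀ n : ℤ, Tendsto (V n) (𝓝[<] 0) (𝓝 (v n))) (n : ℤ) :
    HasSum (fun j : ℕ => ((bigLam ε₀ ^ (n + j))⁻¹) ^ 2 * v (n + j) ^ 2)
      (((bigLam ε₀ ^ n)⁻¹) ^ 2 * v n ^ 2 / (1 - κ ^ 2 / bigLam ε₀ ^ 2)) := by
  have hΛ : 0 < bigLam ε₀ := bigLam_pos (by linarith)
  set r : ℝ := κ ^ 2 / bigLam ε₀ ^ 2 with hr
  have hr0 : 0 ≤ r := div_nonneg (sq_nonneg _) (sq_nonneg _)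
  have hr1 : r < 1 := by
    rw [hr, div_lt_one (pow_pos hΛ 2)]
    exact pow_lt_pow_left₀ hκΛ hκ.le two_ne_zero
  have hgeo := (hasSum_geometric_of_lt_one hr0 hr1).mul_left (((bigLam ε₀ ^ n)⁻¹) ^ 2 * v n ^ 2)
  have e : ∀ j : ℕ, ((bigLam ε₀ ^ (n + j))⁻¹) ^ 2 * v (n + j) ^ 2
      = ((bigLam ε₀ ^ n)⁻¹) ^ 2 * v n ^ 2 * r ^ j := by
    intro j
    rw [dss_terminal_shift hκ hdss hv n j, weight_shift hΛ.ne' n j, hr, div_pow, ← pow_mul, ← pow_mul]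
    have h2 : bigLam ε₀ ^ (2 * j) ≠ 0 := pow_ne_zero _ hΛ.ne'
    have hn0 : bigLam ε₀ ^ n ≠ 0 := zpow_ne_zero n hΛ.ne'
    field_simp
    ring
  rw [div_eq_mul_inv, show (fun j : ℕ => ((bigLam ε₀ ^ (n + j))⁻¹) ^ 2 * v (n + j) ^ 2)
      = fun j : ℕ => ((bigLam ε₀ ^ n)⁻¹) ^ 2 * v n ^ 2 * r ^ j from funext e]
  exact hgeo

/-! ## The overshoot floor -/

/-- **THE OVERSHOOT FLOOR OF A DSS FRONT.**  For a non-negative period-one DSS solution of the critical chain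
(`V_{k+1}(t) = κV_k(κt)`, `0 < κ < Λ`) born at rest, with terminal values `v_k` and lifetime-integrable feeds, drains and fluxes,
every bound `S` of shell `n` on `t < 0` satisfies

  `v_n · (Λ² − κ√κ) / (2(Λ² − κ²)) ≤ S`.

(From (I1)+(AM–GM)+(scaling): `(Λ − κ√κ/Λ)∫V_{n-1}² ≤ v_n`; from (I2)+(D): `Λ^{-2n}v_n²/(1−κ²/Λ²) ≤ ∫Π_{n-1} ≤ 2Λ^{1-2n}S∫V_{n-1}²`.)
[cite: Tao2016AveragedNS, §1.2, §4 Lemma 4.1 (4.8)–(4.10), §6.4; elementary] -/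
theorem dss_overshoot_floor (hε : 0 < ε₀) (hκ : 0 < κ) (hκΛ : κ < bigLam ε₀)
    (hV : ∀ (n : ℤ) (t : ℝ), t < 0 →
      HasDerivAt (V n) (bigLam ε₀ * V (n - 1) t ^ 2 - (bigLam ε₀)⁻¹ * (V n t * V (n + 1) t)) t)
    (hpos : ∀ (n : ℤ) (t : ℝ), t < 0 → 0 ≤ V n t)
    (hdss : ∀ (n : ℤ) (t : ℝ), t < 0 → V (n + 1) t = κ * V n (κ * t))
    (hP : ∀ k t, P k t = 2 * (((bigLam ε₀ ^ k)⁻¹) ^ 2 * (bigLam ε₀)⁻¹) * (V k t ^ 2 * V (k + 1) t))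
    (hv : ∀ n : ℤ, Tendsto (V n) (𝓝[<] 0) (𝓝 (v n)))
    (hpast : ∀ k : ℤ, Tendsto (V k) atBot (𝓝 0))
    (hsq : ∀ k : ℤ, IntegrableOn (fun t => V k t ^ 2) (Iic 0))
    (hdr : ∀ k : ℤ, IntegrableOn (fun t => V k t * V (k + 1) t) (Iic 0))
    (hPint : ∀ k : ℤ, IntegrableOn (P k) (Iic 0))
    (n : ℤ) {S : ℝ} (hS : ∀ t : ℝ, t < 0 → V n t ≤ S) :
    v n * ((bigLam ε₀ ^ 2 - κ * Real.sqrt κ) / (2 * (bigLam ε₀ ^ 2 - κ ^ 2))) ≤ S := by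
  have hΛ : 0 < bigLam ε₀ := bigLam_pos (by linarith)
  have hΛne : bigLam ε₀ ≠ 0 := hΛ.ne'
  have hS0 : 0 ≤ S := (hpos n (-1) (by norm_num)).trans (hS (-1) (by norm_num))
  have hvn : 0 ≤ v n := ge_of_tendsto (hv n) (eventually_nhdsWithin_of_forall fun t ht => hpos n t ht)
  -- the gap `Λ² − κ²` and `Λ² − κ√κ` are positive
  have hκ2 : κ ^ 2 < bigLam ε₀ ^ 2 := pow_lt_pow_left₀ hκΛ hκ.le two_ne_zero
  have hsqrt : Real.sqrt κ < bigLam ε₀ := by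
    have hΛ1 : 1 < bigLam ε₀ := Real.one_lt_rpow (by linarith) (by norm_num)
    rw [Real.sqrt_lt' hΛ]
    nlinarith
  have hgap : 0 < bigLam ε₀ ^ 2 - κ * Real.sqrt κ := by
    have : κ * Real.sqrt κ < bigLam ε₀ * bigLam ε₀ :=
      mul_lt_mul'' hκΛ hsqrt hκ.le (Real.sqrt_nonneg κ)
    nlinarith
  -- Step 1: feed ≤ terminal
  set I := ∫ t in Iio 0, V (n - 1) t ^ 2 with hI
  have hI0 : 0 ≤ I := setIntegral_nonneg measurableSet_Iio fun t _ => sq_nonneg _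
  have h1 : (bigLam ε₀ - κ * Real.sqrt κ / bigLam ε₀) * I ≤ v n :=
    feed_le_terminal hκ hV hdss hv hpast hsq hdr hε n
  -- Step 2: stranded energy ≤ flux ≤ 2Λ^{-2(n-1)}Λ⁻¹ S I
  have h2 : ∫ t in Iio 0, P (n - 1) t ≤ 2 * (((bigLam ε₀ ^ (n - 1))⁻¹) ^ 2 * (bigLam ε₀)⁻¹) * S * I :=
    flux_le_sup_mul_feed hε hP hsq hPint n hS
  have h3 : (∑' j : ℕ, ((bigLam ε₀ ^ (n - 1 + 1 + j))⁻¹) ^ 2 * v (n - 1 + 1 + j) ^ 2) ≤ ∫ t in Iio 0, P (n - 1) t :=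
    EnergyFluxIdentity.strandedEnergy_le_flux hε hV hpos hP hv hpast hPint (n - 1)
  simp only [sub_add_cancel] at h3
  have h4 : (∑' j : ℕ, ((bigLam ε₀ ^ (n + j))⁻¹) ^ 2 * v (n + j) ^ 2)
      = ((bigLam ε₀ ^ n)⁻¹) ^ 2 * v n ^ 2 / (1 - κ ^ 2 / bigLam ε₀ ^ 2) :=
    (strandedEnergy_dss_hasSum hε hκ hκΛ hdss hv n).tsum_eq
  rw [h4] at h3
  -- Step 3: algebra.  Put `w := Λ^{-2n} > 0`; note `2Λ^{-2(n-1)}Λ⁻¹ = 2 w Λ`.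
  have hw : 0 < ((bigLam ε₀ ^ n)⁻¹) ^ 2 := by positivity
  have hwt : 2 * (((bigLam ε₀ ^ (n - 1))⁻¹) ^ 2 * (bigLam ε₀)⁻¹) = 2 * ((bigLam ε₀ ^ n)⁻¹) ^ 2 * bigLam ε₀ := by
    rw [zpow_sub_one₀ hΛne n]
    have : bigLam ε₀ ^ n ≠ 0 := zpow_ne_zero n hΛne
    field_simp
  rw [hwt] at h2
  -- chain: w v² /(1-κ²/Λ²) ≤ 2 w Λ S I and (Λ - κ√κ/Λ) I ≤ v
  have hden : 0 < 1 - κ ^ 2 / bigLam ε₀ ^ 2 := by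
    rw [sub_pos, div_lt_one (pow_pos hΛ 2)]; exact hκ2
  have h5 : ((bigLam ε₀ ^ n)⁻¹) ^ 2 * v n ^ 2 / (1 - κ ^ 2 / bigLam ε₀ ^ 2)
      ≤ 2 * ((bigLam ε₀ ^ n)⁻¹) ^ 2 * bigLam ε₀ * S * I := h3.trans h2
  -- multiply `h1` by `2 w Λ S ≥ 0` and compare
  have hcoef : 0 ≤ 2 * ((bigLam ε₀ ^ n)⁻¹) ^ 2 * bigLam ε₀ * S := by positivity
  have h6 : 2 * ((bigLam ε₀ ^ n)⁻¹) ^ 2 * bigLam ε₀ * S * ((bigLam ε₀ - κ * Real.sqrt κ / bigLam ε₀) * I)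
      ≤ 2 * ((bigLam ε₀ ^ n)⁻¹) ^ 2 * bigLam ε₀ * S * v n :=
    mul_le_mul_of_nonneg_left h1 hcoef
  have hfac : 0 < bigLam ε₀ - κ * Real.sqrt κ / bigLam ε₀ := by
    rw [sub_pos, div_lt_iff₀ hΛ]; nlinarith
  -- from h5: w v² ≤ (1-κ²/Λ²) · 2wΛ S I ; from h6: 2wΛ S I ≤ 2wΛ S v /(Λ - κ√κ/Λ)
  have h5' : ((bigLam ε₀ ^ n)⁻¹) ^ 2 * v n ^ 2
      ≤ (1 - κ ^ 2 / bigLam ε₀ ^ 2) * (2 * ((bigLam ε₀ ^ n)⁻¹) ^ 2 * bigLam ε₀ * S * I) := by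
    have h55 := (div_le_iff₀ hden).1 h5
    linarith [h55]
  have h6' : 2 * ((bigLam ε₀ ^ n)⁻¹) ^ 2 * bigLam ε₀ * S * I
      ≤ 2 * ((bigLam ε₀ ^ n)⁻¹) ^ 2 * bigLam ε₀ * S * v n / (bigLam ε₀ - κ * Real.sqrt κ / bigLam ε₀) :=
    (le_div_iff₀ hfac).2 (by linarith [h6])
  have h7 : ((bigLam ε₀ ^ n)⁻¹) ^ 2 * v n ^ 2
      ≤ (1 - κ ^ 2 / bigLam ε₀ ^ 2) *
        (2 * ((bigLam ε₀ ^ n)⁻¹) ^ 2 * bigLam ε₀ * S * v n / (bigLam ε₀ - κ * Real.sqrt κ / bigLam ε₀)) :=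
    h5'.trans (mul_le_mul_of_nonneg_left h6' hden.le)
  -- divide by `w · v n` (if `v n = 0` the claim is `0 ≤ S`)
  rcases eq_or_lt_of_le hvn with hv0 | hvpos
  · rw [← hv0, zero_mul]; exact hS0
  · -- rewrite the target as a consequence of h7
    have key : v n * ((bigLam ε₀ ^ 2 - κ * Real.sqrt κ) / (2 * (bigLam ε₀ ^ 2 - κ ^ 2)))
        = (((bigLam ε₀ ^ n)⁻¹) ^ 2 * v n ^ 2) /
          (((bigLam ε₀ ^ n)⁻¹) ^ 2 * v n * ((1 - κ ^ 2 / bigLam ε₀ ^ 2) * (2 * bigLam ε₀)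
            / (bigLam ε₀ - κ * Real.sqrt κ / bigLam ε₀))) := by
      field_simp
    have hpos' : 0 < ((bigLam ε₀ ^ n)⁻¹) ^ 2 * v n * ((1 - κ ^ 2 / bigLam ε₀ ^ 2) * (2 * bigLam ε₀)
            / (bigLam ε₀ - κ * Real.sqrt κ / bigLam ε₀)) := by positivity
    rw [key, div_le_iff₀ hpos']
    calc ((bigLam ε₀ ^ n)⁻¹) ^ 2 * v n ^ 2
        ≤ (1 - κ ^ 2 / bigLam ε₀ ^ 2) *
          (2 * ((bigLam ε₀ ^ n)⁻¹) ^ 2 * bigLam ε₀ * S * v n / (bigLam ε₀ - κ * Real.sqrt κ / bigLam ε₀)) := h7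
      _ = S * (((bigLam ε₀ ^ n)⁻¹) ^ 2 * v n * ((1 - κ ^ 2 / bigLam ε₀ ^ 2) * (2 * bigLam ε₀)
            / (bigLam ε₀ - κ * Real.sqrt κ / bigLam ε₀))) := by
          field_simp

/-- **Strict overshoot beyond the threshold.**  If moreover `2κ² − κ√κ > Λ²` (as the base tends to one: `κ ≥ Λ^θ` with
`θ > 4/5`), the overshoot factor exceeds one: every bound `S` of a lit shell satisfies `v_n < S`... in the form `v_n · 1 < v_n · factor ≤ S`.
[cite: Tao2016AveragedNS, §1.2, §4, §6.4; elementary] -/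
theorem one_lt_overshootFactor {Λ κ : ℝ} (hκ : 0 < κ) (hκΛ : κ < Λ) (h : Λ ^ 2 < 2 * κ ^ 2 - κ * Real.sqrt κ) :
    1 < (Λ ^ 2 - κ * Real.sqrt κ) / (2 * (Λ ^ 2 - κ ^ 2)) := by
  have hgap : 0 < Λ ^ 2 - κ ^ 2 := by nlinarith
  rw [lt_div_iff₀ (by linarith)]
  linarith

/-- **(S₁)-type survivors overshoot strictly**: under the hypotheses of `dss_overshoot_floor`, if `2κ² − κ√κ > Λ²` and shell `n` is lit
(`v_n > 0`), then every bound `S ≥ V_n` on `t < 0` has `v_n < S` — quantitatively `v_n · (Λ² − κ√κ)/(2(Λ²−κ²)) ≤ S` with a factor `> 1`.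
[cite: Tao2016AveragedNS, §1.2, §4, §6.4; elementary] -/
theorem dss_strict_overshoot (hε : 0 < ε₀) (hκ : 0 < κ) (hκΛ : κ < bigLam ε₀)
    (hV : ∀ (n : ℤ) (t : ℝ), t < 0 →
      HasDerivAt (V n) (bigLam ε₀ * V (n - 1) t ^ 2 - (bigLam ε₀)⁻¹ * (V n t * V (n + 1) t)) t)
    (hpos : ∀ (n : ℤ) (t : ℝ), t < 0 → 0 ≤ V n t)
    (hdss : ∀ (n : ℤ) (t : ℝ), t < 0 → V (n + 1) t = κ * V n (κ * t))
    (hP : ∀ k t, P k t = 2 * (((bigLam ε₀ ^ k)⁻¹) ^ 2 * (bigLam ε₀)⁻¹) * (V k t ^ 2 * V (k + 1) t))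
    (hv : ∀ n : ℤ, Tendsto (V n) (𝓝[<] 0) (𝓝 (v n)))
    (hpast : ∀ k : ℤ, Tendsto (V k) atBot (𝓝 0))
    (hsq : ∀ k : ℤ, IntegrableOn (fun t => V k t ^ 2) (Iic 0))
    (hdr : ∀ k : ℤ, IntegrableOn (fun t => V k t * V (k + 1) t) (Iic 0))
    (hPint : ∀ k : ℤ, IntegrableOn (P k) (Iic 0))
    (hthr : bigLam ε₀ ^ 2 < 2 * κ ^ 2 - κ * Real.sqrt κ)
    (n : ℤ) (hvn : 0 < v n) {S : ℝ} (hS : ∀ t : ℝ, t < 0 → V n t ≤ S) : v n < S := by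
  have h := dss_overshoot_floor hε hκ hκΛ hV hpos hdss hP hv hpast hsq hdr hPint n hS
  have hf := one_lt_overshootFactor hκ hκΛ hthr
  have : v n * 1 < v n * ((bigLam ε₀ ^ 2 - κ * Real.sqrt κ) / (2 * (bigLam ε₀ ^ 2 - κ ^ 2))) :=
    mul_lt_mul_of_pos_left hf hvn
  linarith

/-- **Quantitative sub-unitarity from an overshoot ceiling.**  If shell `n` is lit and never exceeds `(1+Ω)·v_n` (e.g. the tree's
no-overshoot bound with `1+Ω = e^{M/Λ}`), then `Λ² − κ√κ ≤ 2(1+Ω)(Λ² − κ²)`: the front's contraction ratio stays away from `Λ` by an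
amount controlled by the overshoot ceiling alone.  [cite: Tao2016AveragedNS, §1.2, §4, §6.4; elementary] -/
theorem dss_subunitary_quantitative (hε : 0 < ε₀) (hκ : 0 < κ) (hκΛ : κ < bigLam ε₀)
    (hV : ∀ (n : ℤ) (t : ℝ), t < 0 →
      HasDerivAt (V n) (bigLam ε₀ * V (n - 1) t ^ 2 - (bigLam ε₀)⁻¹ * (V n t * V (n + 1) t)) t)
    (hpos : ∀ (n : ℤ) (t : ℝ), t < 0 → 0 ≤ V n t)
    (hdss : ∀ (n : ℤ) (t : ℝ), t < 0 → V (n + 1) t = κ * V n (κ * t))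
    (hP : ∀ k t, P k t = 2 * (((bigLam ε₀ ^ k)⁻¹) ^ 2 * (bigLam ε₀)⁻¹) * (V k t ^ 2 * V (k + 1) t))
    (hv : ∀ n : ℤ, Tendsto (V n) (𝓝[<] 0) (𝓝 (v n)))
    (hpast : ∀ k : ℤ, Tendsto (V k) atBot (𝓝 0))
    (hsq : ∀ k : ℤ, IntegrableOn (fun t => V k t ^ 2) (Iic 0))
    (hdr : ∀ k : ℤ, IntegrableOn (fun t => V k t * V (k + 1) t) (Iic 0))
    (hPint : ∀ k : ℤ, IntegrableOn (P k) (Iic 0))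
    (n : ℤ) (hvn : 0 < v n) {Ω : ℝ} (hΩ : ∀ t : ℝ, t < 0 → V n t ≤ (1 + Ω) * v n) :
    bigLam ε₀ ^ 2 - κ * Real.sqrt κ ≤ 2 * (1 + Ω) * (bigLam ε₀ ^ 2 - κ ^ 2) := by
  have h := dss_overshoot_floor hε hκ hκΛ hV hpos hdss hP hv hpast hsq hdr hPint n hΩ
  have hgap : 0 < bigLam ε₀ ^ 2 - κ ^ 2 := by
    have := pow_lt_pow_left₀ hκΛ hκ.le two_ne_zero; linarith
  have h' : (bigLam ε₀ ^ 2 - κ * Real.sqrt κ) / (2 * (bigLam ε₀ ^ 2 - κ ^ 2)) ≤ 1 + Ω := by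
    have := le_of_mul_le_mul_left (by linarith [h] : v n * ((bigLam ε₀ ^ 2 - κ * Real.sqrt κ) /
      (2 * (bigLam ε₀ ^ 2 - κ ^ 2))) ≤ v n * (1 + Ω)) hvn
    exact this
  have h'' := (div_le_iff₀ (by linarith : (0 : ℝ) < 2 * (bigLam ε₀ ^ 2 - κ ^ 2))).1 h'
  nlinarith [h'']

end Summit.NavierStokesRegularity.NavierStokesRegularity.Theorems.NoSurvivingEternalViscBddOne.DSSOvershootFloor
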